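import Summits.QuantumFields.BalabanUV.T4Continuum.Support.ShellMeasureExpJacobianSUN
import Mathlib.RingTheory.Norm.Transitivity
import Mathlib.RingTheory.Complex

/-!
# `T4Continuum.ShellMeasureDuhamelHadamardSUN` — the ALGEBRAIC Duhamel operator of the exponential chart of `SU(N)`
# (`X ↦ U (C ⊙ (U* X U)) U*` on `𝔰𝔲(N)`, `C_ab = (e^{i(θ_b−θ_a)} − 1)/(i(θ_b−θ_a))`) and its REAL DETERMINANT
# `∏_{i<j} sinc²((θ_j−θ_i)/2)`
# (cell `pub-balaban`, sub-cell `t4`, spine estimate NE7c (node U5b); ROUND-2 crew `t4-ne7c-formalise-*`, row S3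
# «SM-L9 SU(N) chart» of `t4/b2b-balaban-t4-ne7c-p1/LEAVES-NE7c-P1.md` (trigger `t4/T4-NE7c-TRIGGER.json`, c5:
# optional and last — `SU(2)` is the row's certified instance), the (CH)₁ line for `N ≥ 3` (GAPS G-ne7cL04-1; route
# memo `HOME/b2b-balaban-t4-ne7c-formalise-leaf-09/g5/ROUTE-CH1-SUN.md`, STEP 2; journal `CLAIMS.log` l.10254); seat
# `b2b-balaban-t4-ne7c-formalise-leaf-09` (gen 6); file 1 of 2, consumed by `ShellMeasureExpDuhamelDetSUN` (the bridge
# to the Duhamel INTEGRAL and the determinant of the chart operator); tree target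
# `Summits/QuantumFields/BalabanUV/T4Continuum/Support/`; ADDITIVE — imports S3 f4 `ShellMeasureExpJacobianSUN` (the
# pair identity `normSq_cexp_sub_cexp`, the chart `ChartSU`/`coordSU`/`genSU`, `lieSU`) and two Mathlib leaves
# (`LinearMap.det_restrictScalars`, `Algebra.norm_complex_apply`) and modifies nothing)

HONEST FRAMING.  Finite four-torus programme, rung (B)+1 only — NOT infinite volume, NOT a mass gap, NOT the Clay
problem, NOT summit progress.  Nothing of [Balaban 1983–89] is mentioned or asserted; NE7c NOT proved and not touched
(spine PROVED 0/9); the chart identity (CH)₁ for `N ≥ 3` (S3 f5's displayed binder `hCH`) stays DISPLAYED — this file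
is one algebraic brick of its line.  PURE FINITE-DIMENSIONAL LINEAR ALGEBRA over `ℝ`/`ℂ`, [folklore], 0 sorry,
0 citations, no `def … : Prop` (the data definitions `duhCoeff`, `diag0`, `mkSU`, `split*`, `hadL`, `hadSU`, `mulP`,
`adSU`, `duhMat`, `duhOp` are objects, not statements).

WHY.  The left-trivialised derivative of the exponential chart `v ↦ exp (genSU v)` of `SU(N)` is
`h ↦ exp X · ∫₀¹ e^{−rX} (genSU h) e^{rX} dr`, `X = genSU v` (`Literature.Analysis.Calculus.ExpDuhamel`); in a unitary
frame diagonalising `H(v) = −iX = U·diag θ·U*` the Duhamel operator `H ↦ ∫₀¹ e^{−rX} H e^{rX} dr` is ENTRYWISE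
multiplication by `C_ab = Φ(θ_b − θ_a)`, `Φ(φ) = ∫₀¹ e^{irφ} dr = (e^{iφ} − 1)/(iφ)`, after conjugation by `U`
(the companion file proves that integral identity).  This file computes the REAL determinant of that algebraic operator
on `𝔰𝔲(N)`: it is `∏_{i<j} |Φ(θ_j − θ_i)|² = ∏_{i<j} sinc²((θ_j − θ_i)/2)` — the root-space product of S3 f4's
`ShellMeasureExpJacobianSUN.expJacSU_eq_prod_sinc`, i.e. the exponential Haar Jacobian.  No basis of `𝔰𝔲(N)` is
built: the operator is conjugated (`LinearMap.det_conj`) into the SPLITTING `𝔰𝔲(N) ≃ₗ[ℝ] (traceless real diagonals)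
× (strictly upper entries `{a<b} → ℂ`)`, where it is `id × (coordinatewise multiplication by C_ab)`; the real
determinant of a `ℂ`-linear map is `|det_ℂ|²` (`LinearMap.det_restrictScalars`, `Algebra.norm_complex_apply`).

THE POINTS.
* §1 THE DUHAMEL COEFFICIENT `Φ` (`duhCoeff`): `|Φ(φ)|² = sinc²(φ/2)` (`normSq_duhCoeff`), `conj Φ(φ) = Φ(−φ)`.
* §2 THE SPLITTING (`split : lieSU (Fin N) ≃ₗ[ℝ] diag0 N × (Pairs N → ℂ)`): a trace-free skew-Hermitian matrix is
  its imaginary diagonal (summing to `0`) and its strictly upper entries (`mkSU` the skew-Hermitian completion).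
* §3 HADAMARD MULTIPLICATION by a unit-diagonal Hermitian `C` preserves `𝔰𝔲(N)` (`hadSU`), is `id × mulP C` in the
  splitting (`split_hadSU`), and has REAL determinant `∏_{a<b} |C a b|²` (`det_hadSU`; `prod_pairs_eq` re-indexes to
  `∏ i, ∏ j ∈ Ioi i`).
* §4 THE FRAME: conjugation by a unitary `U` on `𝔰𝔲(N)` (`adSU`), the coefficient matrix `duhMat θ`, the ALGEBRAIC
  DUHAMEL OPERATOR `duhOp U θ = adSU U ∘ hadSU (duhMat θ) ∘ (adSU U)⁻¹` with
  **`det (duhOp U θ) = ∏_{i<j} sinc²((θ_j−θ_i)/2)`** (`det_duhOp`).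

WHAT THIS DOES NOT DO.  No integral, no derivative, no measure: the identification of the algebraic operator with the
Duhamel integral and the statements about the chart differential are in `ShellMeasureExpDuhamelDetSUN`; (CH)₁ itself
needs in addition the Hausdorff-measure/area-formula files (H)/(AF) (seat `leaf-10`, `CLAIMS.log` l.10221), the chart
derivative (STEP 1, seat `leaf-08`, l.10111) and the Lebesgue-nullity of the non-regular cone.  NE7c NOT proved.
-/

noncomputable section

namespace Summit.QuantumFields.BalabanUV.T4Continuum.ShellMeasureDuhamelHadamardSUN

open Matrix Finset
open scoped ComplexConjugate
open Complex (I normSq)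
open Literature.MathematicalPhysics.QuantumFieldTheory.Balaban1983to89
open T4AdjointCovarianceUnitary (lieSU mem_lieSU_iff)
open ShellMeasureVandermondeSUN ShellMeasureExpChartSUN ShellMeasureExpJacobianSUN

variable {N : ℕ}

local notation "𝕄" => Matrix (Fin N) (Fin N) ℂ

/-! ## §1 The Duhamel coefficient `Φ(φ) = ∫₀¹ e^{irφ} dr` -/

section Coeff

/-- THE DUHAMEL COEFFICIENT `Φ(φ) = (e^{iφ} − 1)/(iφ)` for `φ ≠ 0`, `Φ(0) = 1` (`= ∫₀¹ e^{irφ} dr`). [folklore] -/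
def duhCoeff (φ : ℝ) : ℂ := if φ = 0 then 1 else (Complex.exp (φ * I) - 1) / (φ * I)

/-- `Φ(0) = 1`. [folklore] -/
@[simp] theorem duhCoeff_zero : duhCoeff 0 = 1 := if_pos rfl

/-- `Φ(φ) = (e^{iφ} − 1)/(iφ)` for `φ ≠ 0`. [folklore] -/
theorem duhCoeff_of_ne_zero {φ : ℝ} (hφ : φ ≠ 0) : duhCoeff φ = (Complex.exp (φ * I) - 1) / (φ * I) := if_neg hφ

/-- **`|Φ(φ)|² = sinc²(φ/2)`** (the pair identity `|e^{iφ} − 1|² = φ²·sinc²(φ/2)`). [folklore] -/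
theorem normSq_duhCoeff (φ : ℝ) : normSq (duhCoeff φ) = Real.sinc (φ / 2) ^ 2 := by
  by_cases hφ : φ = 0
  · rw [hφ, duhCoeff_zero, map_one, zero_div, Real.sinc_zero, one_pow]
  · rw [duhCoeff_of_ne_zero hφ, map_div₀, Complex.normSq_mul, Complex.normSq_I, mul_one, Complex.normSq_ofReal]
    have h := normSq_cexp_sub_cexp φ 0
    rw [Complex.ofReal_zero, zero_mul, Complex.exp_zero, sub_zero] at h
    rw [h]
    field_simp

/-- `conj Φ(φ) = Φ(−φ)`. [folklore] -/
theorem conj_duhCoeff (φ : ℝ) : conj (duhCoeff φ) = duhCoeff (-φ) := by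
  by_cases hφ : φ = 0
  · rw [hφ, neg_zero, duhCoeff_zero, map_one]
  · rw [duhCoeff_of_ne_zero hφ, duhCoeff_of_ne_zero (neg_ne_zero.mpr hφ), map_div₀, map_sub, map_one, map_mul,
      Complex.conj_ofReal, Complex.conj_I, ← Complex.exp_conj, map_mul, Complex.conj_ofReal, Complex.conj_I,
      Complex.ofReal_neg]
    ring_nf

end Coeff

/-! ## §2 The splitting `𝔰𝔲(N) ≃ₗ[ℝ] (traceless real diagonals) × (strictly upper entries)` -/

section Split

/-- the strictly upper index pairs `a < b`. [folklore] -/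
abbrev Pairs (N : ℕ) : Type := {p : Fin N × Fin N // p.1 < p.2}

/-- the traceless real diagonals: the kernel of the coordinate sum on `Fin N → ℝ`. [folklore] -/
def diag0 (N : ℕ) : Submodule ℝ (Fin N → ℝ) := LinearMap.ker (∑ a : Fin N, LinearMap.proj a)

/-- membership in `diag0`: the coordinates sum to `0`. [folklore] -/
theorem mem_diag0 {d : Fin N → ℝ} : d ∈ diag0 N ↔ ∑ a, d a = 0 := by
  rw [diag0, LinearMap.mem_ker, LinearMap.sum_apply]
  rfl

/-- a skew-Hermitian matrix has imaginary diagonal: `X a a = (Im X a a) · i`. [folklore] -/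
theorem diag_eq_of_star_eq_neg {X : 𝕄} (hX : star X = -X) (a : Fin N) : X a a = ((X a a).im : ℂ) * I := by
  have h := congr_fun (congr_fun hX a) a
  rw [star_apply, Matrix.neg_apply, Complex.star_def] at h
  have hre : (X a a).re = 0 := by
    have := congr_arg Complex.re h
    rw [Complex.conj_re, Complex.neg_re] at this
    linarith
  apply Complex.ext
  · simp [hre]
  · simp

/-- a skew-Hermitian matrix has `X a b = −conj (X b a)`. [folklore] -/
theorem apply_eq_neg_conj_of_star_eq_neg {X : 𝕄} (hX : star X = -X) (a b : Fin N) : X a b = -conj (X b a) := by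
  have h := congr_fun (congr_fun hX a) b
  rw [star_apply, Matrix.neg_apply, Complex.star_def] at h
  rw [h, neg_neg]

/-- THE MATRIX with traceless imaginary diagonal `d` and strictly upper entries `f` (skew-Hermitian completion).
[folklore] -/
def mkSU (d : Fin N → ℝ) (f : Pairs N → ℂ) : 𝕄 :=
  of fun a b => if h : a < b then f ⟨(a, b), h⟩ else if h' : b < a then -conj (f ⟨(b, a), h'⟩) else (d a : ℂ) * I

/-- strictly upper entries of the completion. [folklore] -/
theorem mkSU_apply_lt (d : Fin N → ℝ) (f : Pairs N → ℂ) {a b : Fin N} (h : a < b) :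
    mkSU d f a b = f ⟨(a, b), h⟩ := by
  simp [mkSU, h]

/-- strictly lower entries of the completion. [folklore] -/
theorem mkSU_apply_gt (d : Fin N → ℝ) (f : Pairs N → ℂ) {a b : Fin N} (h : b < a) :
    mkSU d f a b = -conj (f ⟨(b, a), h⟩) := by
  simp [mkSU, h, lt_asymm h]

/-- diagonal entries of the completion. [folklore] -/
theorem mkSU_apply_diag (d : Fin N → ℝ) (f : Pairs N → ℂ) (a : Fin N) : mkSU d f a a = (d a : ℂ) * I := by
  simp [mkSU]

/-- the completion is skew-Hermitian, and trace-free when `Σ d = 0`. [folklore] -/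
theorem mkSU_mem {d : Fin N → ℝ} (hd : ∑ a, d a = 0) (f : Pairs N → ℂ) : mkSU d f ∈ lieSU (Fin N) := by
  rw [mem_lieSU_iff]
  refine ⟨?_, ?_⟩
  · ext a b
    rw [star_apply, Matrix.neg_apply, Complex.star_def]
    rcases lt_trichotomy a b with h | h | h
    · rw [mkSU_apply_lt d f h, mkSU_apply_gt d f h, map_neg, Complex.conj_conj]
    · subst h
      rw [mkSU_apply_diag, map_mul, Complex.conj_ofReal, Complex.conj_I, mul_neg]
    · rw [mkSU_apply_gt d f h, mkSU_apply_lt d f h, neg_neg]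
  · rw [Matrix.trace]
    simp_rw [Matrix.diag_apply, mkSU_apply_diag, ← Finset.sum_mul, ← Complex.ofReal_sum, hd, Complex.ofReal_zero,
      zero_mul]

/-- THE SPLITTING, forward: imaginary parts of the diagonal and the strictly upper entries. [folklore] -/
def splitFwd : lieSU (Fin N) →ₗ[ℝ] ↥(diag0 N) × (Pairs N → ℂ) where
  toFun X := (⟨fun a => ((X : 𝕄) a a).im, by
      rw [mem_diag0, ← Complex.im_sum]
      have h : (∑ a, (X : 𝕄) a a) = (X : 𝕄).trace := rfl
      rw [h, (mem_lieSU_iff.mp X.2).2, Complex.zero_im]⟩,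
    fun p => (X : 𝕄) p.1.1 p.1.2)
  map_add' X Y := by
    ext a
    · simp
    · simp
  map_smul' c X := by
    ext a
    · simp
    · simp

/-- THE SPLITTING, backward: the skew-Hermitian completion. [folklore] -/
def splitBwd : ↥(diag0 N) × (Pairs N → ℂ) →ₗ[ℝ] lieSU (Fin N) where
  toFun df := ⟨mkSU df.1 df.2, mkSU_mem (mem_diag0.mp df.1.2) df.2⟩
  map_add' x y := by
    apply Subtype.ext
    ext a b
    simp only [Submodule.coe_add, Matrix.add_apply, Prod.fst_add, Prod.snd_add]
    rcases lt_trichotomy a b with h | h | h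
    · simp [mkSU_apply_lt _ _ h]
    · subst h; simp [mkSU_apply_diag]; ring
    · simp [mkSU_apply_gt _ _ h]; ring
  map_smul' c x := by
    apply Subtype.ext
    ext a b
    simp only [Submodule.coe_smul, Matrix.smul_apply, Prod.smul_fst, Prod.smul_snd, RingHom.id_apply]
    rcases lt_trichotomy a b with h | h | h
    · simp [mkSU_apply_lt _ _ h]
    · subst h; simp [mkSU_apply_diag, Complex.real_smul]; ring
    · simp [mkSU_apply_gt _ _ h, Complex.real_smul]

/-- **THE SPLITTING** `𝔰𝔲(N) ≃ₗ[ℝ] (traceless real diagonals) × (strictly upper entries)`. [folklore] -/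
def split : lieSU (Fin N) ≃ₗ[ℝ] ↥(diag0 N) × (Pairs N → ℂ) :=
  LinearEquiv.ofLinear splitFwd splitBwd
    (by
      apply LinearMap.ext
      intro df
      obtain ⟨d, f⟩ := df
      rw [LinearMap.comp_apply, LinearMap.id_apply]
      ext a
      · show (mkSU d f a a).im = (d : Fin N → ℝ) a
        rw [mkSU_apply_diag]; simp
      · show mkSU d f a.1.1 a.1.2 = f a
        rw [mkSU_apply_lt _ _ a.2])
    (by
      apply LinearMap.ext
      intro X
      rw [LinearMap.comp_apply, LinearMap.id_apply]
      apply Subtype.ext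
      ext a b
      show mkSU (fun a => ((X : 𝕄) a a).im) (fun p => (X : 𝕄) p.1.1 p.1.2) a b = (X : 𝕄) a b
      have hX := (mem_lieSU_iff.mp X.2).1
      rcases lt_trichotomy a b with h | h | h
      · rw [mkSU_apply_lt _ _ h]
      · subst h; rw [mkSU_apply_diag, ← diag_eq_of_star_eq_neg hX]
      · rw [mkSU_apply_gt _ _ h, ← apply_eq_neg_conj_of_star_eq_neg hX])

/-- first component of the splitting. [folklore] -/
@[simp] theorem split_apply_fst (X : lieSU (Fin N)) (a : Fin N) : ((split X).1 : Fin N → ℝ) a = ((X : 𝕄) a a).im := rfl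

/-- second component of the splitting. [folklore] -/
@[simp] theorem split_apply_snd (X : lieSU (Fin N)) (p : Pairs N) : (split X).2 p = (X : 𝕄) p.1.1 p.1.2 := rfl

end Split

/-! ## §3 Hadamard multiplication by a unit-diagonal Hermitian matrix on `𝔰𝔲(N)` and its REAL determinant -/

section Hadamard

/-- ENTRYWISE (Hadamard) multiplication by `C` as a real-linear map of `M_N(ℂ)`. [folklore] -/
def hadL (C : 𝕄) : 𝕄 →ₗ[ℝ] 𝕄 where
  toFun X := of fun a b => C a b * X a b
  map_add' X Y := by
    ext a b
    simp [mul_add]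
  map_smul' c X := by
    ext a b
    simp [Complex.real_smul, mul_left_comm]

/-- entries of the Hadamard product. [folklore] -/
@[simp] theorem hadL_apply (C X : 𝕄) (a b : Fin N) : hadL C X a b = C a b * X a b := rfl

variable {C : Matrix (Fin N) (Fin N) ℂ} (hCd : ∀ a, C a a = 1) (hCh : ∀ a b, conj (C a b) = C b a)
include hCd hCh

/-- a unit-diagonal Hermitian coefficient matrix preserves `𝔰𝔲(N)`. [folklore] -/
theorem hadL_mem {X : 𝕄} (hX : X ∈ lieSU (Fin N)) : hadL C X ∈ lieSU (Fin N) := by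
  rw [mem_lieSU_iff] at hX ⊢
  obtain ⟨hXs, hXt⟩ := hX
  refine ⟨?_, ?_⟩
  · ext a b
    rw [star_apply, Matrix.neg_apply, hadL_apply, hadL_apply, Complex.star_def, map_mul, hCh,
      apply_eq_neg_conj_of_star_eq_neg hXs a b, mul_neg, neg_neg]
  · have h : (hadL C X).trace = X.trace := by
      simp only [Matrix.trace, Matrix.diag_apply, hadL_apply, hCd, one_mul]
    rw [h, hXt]

/-- THE HADAMARD OPERATOR ON `𝔰𝔲(N)` of a unit-diagonal Hermitian coefficient matrix. [folklore] -/
def hadSU (C : 𝕄) (hCd : ∀ a, C a a = 1) (hCh : ∀ a b, conj (C a b) = C b a) :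
    lieSU (Fin N) →ₗ[ℝ] lieSU (Fin N) :=
  (hadL C).restrict fun _ hX => hadL_mem hCd hCh hX

/-- `hadSU` on underlying matrices. [folklore] -/
@[simp] theorem coe_hadSU (X : lieSU (Fin N)) : ((hadSU C hCd hCh X : lieSU (Fin N)) : 𝕄) = hadL C X := rfl

omit hCd hCh in
/-- COORDINATEWISE MULTIPLICATION by the strictly upper entries of `C` on the pair functions (`ℂ`-linear). [folklore] -/
def mulP (C : 𝕄) : (Pairs N → ℂ) →ₗ[ℂ] (Pairs N → ℂ) := Matrix.toLin' (diagonal fun p : Pairs N => C p.1.1 p.1.2)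

omit hCd hCh in
/-- `mulP` coordinatewise. [folklore] -/
@[simp] theorem mulP_apply (f : Pairs N → ℂ) (p : Pairs N) : mulP C f p = C p.1.1 p.1.2 * f p := by
  simp [mulP, mulVec_diagonal]

/-- in the splitting, the Hadamard operator is `id × (coordinatewise multiplication)`. [folklore] -/
theorem split_hadSU (X : lieSU (Fin N)) :
    split (hadSU C hCd hCh X) = (LinearMap.id.prodMap ((mulP C).restrictScalars ℝ)) (split X) := by
  ext a
  · simp [hCd]
  · simp

/-- the Hadamard operator CONJUGATED into the splitting. [folklore] -/
theorem hadSU_eq_conj :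
    hadSU C hCd hCh =
      (split (N := N)).symm.toLinearMap ∘ₗ (LinearMap.id.prodMap ((mulP C).restrictScalars ℝ)) ∘ₗ
        (split (N := N)).toLinearMap := by
  apply LinearMap.ext
  intro X
  simp only [LinearMap.comp_apply, LinearEquiv.coe_coe]
  rw [← split_hadSU hCd hCh X, LinearEquiv.symm_apply_apply]

omit hCd hCh in
/-- the REAL determinant of the coordinatewise multiplication is `∏_{a<b} |C a b|²`. [folklore] -/
theorem det_mulP_restrictScalars :
    LinearMap.det ((mulP C).restrictScalars ℝ) = ∏ p : Pairs N, normSq (C p.1.1 p.1.2) := by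
  rw [LinearMap.det_restrictScalars, Algebra.norm_complex_apply, mulP, LinearMap.det_toLin', det_diagonal, map_prod]

/-- **THE REAL DETERMINANT OF THE HADAMARD OPERATOR ON `𝔰𝔲(N)` is `∏_{a<b} |C a b|²`.** [folklore] -/
theorem det_hadSU : LinearMap.det (hadSU C hCd hCh) = ∏ p : Pairs N, normSq (C p.1.1 p.1.2) := by
  have h := LinearMap.det_conj (LinearMap.id.prodMap ((mulP C).restrictScalars ℝ)) (split (N := N)).symm
  rw [LinearEquiv.symm_symm, LinearMap.det_prodMap, LinearMap.det_id, one_mul, det_mulP_restrictScalars] at h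
  rw [hadSU_eq_conj hCd hCh]
  exact h

omit hCd hCh in
/-- the product over the strictly upper pairs as an iterated product. [folklore] -/
theorem prod_pairs_eq (g : Fin N → Fin N → ℝ) :
    ∏ p : Pairs N, g p.1.1 p.1.2 = ∏ i : Fin N, ∏ j ∈ Ioi i, g i j := by
  have h1 : ∏ p ∈ univ.filter (fun p : Fin N × Fin N => p.1 < p.2), g p.1 p.2 = ∏ i : Fin N, ∏ j ∈ Ioi i, g i j :=
    Finset.prod_finset_product _ _ _ (fun p => by simp)
  rw [← h1, Finset.prod_subtype (p := fun p : Fin N × Fin N => p.1 < p.2)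
    (univ.filter fun p : Fin N × Fin N => p.1 < p.2) (fun p => by simp)]

end Hadamard

/-! ## §4 The frame: conjugation by a unitary, the Duhamel coefficient matrix, the algebraic Duhamel operator -/

section Frame

open T4AdjointCovarianceUnitary (conjL conjL_apply conj_mem_lieSU conj_conj_of_mul_eq_one)

/-- CONJUGATION BY A UNITARY `U` as a real-linear automorphism of `𝔰𝔲(N)` (inverse: conjugation by `U⁻¹ = U*`;
cf. `T4AdjointCovarianceUnitary.sadEquiv` for special unitary `U`). [folklore] -/
def adSU (U : Matrix.unitaryGroup (Fin N) ℂ) : lieSU (Fin N) ≃ₗ[ℝ] lieSU (Fin N) :=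
  { (conjL (U : 𝕄)).restrict fun _ hX => conj_mem_lieSU hX U with
    invFun := (conjL ((U⁻¹ : Matrix.unitaryGroup (Fin N) ℂ) : 𝕄)).restrict fun _ hX => conj_mem_lieSU hX U⁻¹
    left_inv := fun X => Subtype.ext <| conj_conj_of_mul_eq_one (ShellMeasureVandermondeSUN.star_coe_mul_coe U) (X : 𝕄)
    right_inv := fun X =>
      Subtype.ext <| conj_conj_of_mul_eq_one (ShellMeasureVandermondeSUN.coe_mul_star_coe U) (X : 𝕄) }

/-- `adSU U X = U X U*` on underlying matrices. [folklore] -/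
@[simp] theorem coe_adSU (U : Matrix.unitaryGroup (Fin N) ℂ) (X : lieSU (Fin N)) :
    ((adSU U X : lieSU (Fin N)) : 𝕄) = (U : 𝕄) * X * star (U : 𝕄) := rfl

/-- `(adSU U)⁻¹ X = U* X U` on underlying matrices. [folklore] -/
@[simp] theorem coe_adSU_symm (U : Matrix.unitaryGroup (Fin N) ℂ) (X : lieSU (Fin N)) :
    (((adSU U).symm X : lieSU (Fin N)) : 𝕄) = star (U : 𝕄) * X * (U : 𝕄) := by
  show ((U⁻¹ : Matrix.unitaryGroup (Fin N) ℂ) : 𝕄) * X * star ((U⁻¹ : Matrix.unitaryGroup (Fin N) ℂ) : 𝕄) = _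
  rw [Matrix.UnitaryGroup.inv_val, star_star]

/-- THE DUHAMEL COEFFICIENT MATRIX `C_ab = Φ(θ_b − θ_a)` of a real spectrum `θ`. [folklore] -/
def duhMat (θ : Fin N → ℝ) : 𝕄 := of fun a b => duhCoeff (θ b - θ a)

/-- entries of the coefficient matrix. [folklore] -/
@[simp] theorem duhMat_apply (θ : Fin N → ℝ) (a b : Fin N) : duhMat θ a b = duhCoeff (θ b - θ a) := rfl

/-- unit diagonal. [folklore] -/
theorem duhMat_diag (θ : Fin N → ℝ) : ∀ a, duhMat θ a a = 1 := fun a => by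
  rw [duhMat_apply, sub_self, duhCoeff_zero]

/-- Hermitian. [folklore] -/
theorem duhMat_conj (θ : Fin N → ℝ) : ∀ a b, conj (duhMat θ a b) = duhMat θ b a := fun a b => by
  rw [duhMat_apply, duhMat_apply, conj_duhCoeff, neg_sub]

/-- THE ALGEBRAIC DUHAMEL OPERATOR in the unitary frame `U` with spectrum `θ`:
`X ↦ U (C ⊙ (U* X U)) U*` on `𝔰𝔲(N)`, `C = duhMat θ`. [folklore] -/
def duhOp (U : Matrix.unitaryGroup (Fin N) ℂ) (θ : Fin N → ℝ) : lieSU (Fin N) →ₗ[ℝ] lieSU (Fin N) :=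
  (adSU U).toLinearMap ∘ₗ hadSU (duhMat θ) (duhMat_diag θ) (duhMat_conj θ) ∘ₗ (adSU U).symm.toLinearMap

/-- `duhOp U θ X = U (duhMat θ ⊙ (U* X U)) U*` on underlying matrices. [folklore] -/
theorem coe_duhOp (U : Matrix.unitaryGroup (Fin N) ℂ) (θ : Fin N → ℝ) (X : lieSU (Fin N)) :
    ((duhOp U θ X : lieSU (Fin N)) : 𝕄) = (U : 𝕄) * hadL (duhMat θ) (star (U : 𝕄) * X * (U : 𝕄)) * star (U : 𝕄) := by
  simp only [duhOp, LinearMap.comp_apply, LinearEquiv.coe_coe, coe_adSU, coe_hadSU, coe_adSU_symm]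

/-- **THE DETERMINANT OF THE ALGEBRAIC DUHAMEL OPERATOR** is the root-space product `∏_{i<j} sinc²((θ_j−θ_i)/2)`.
[folklore] -/
theorem det_duhOp (U : Matrix.unitaryGroup (Fin N) ℂ) (θ : Fin N → ℝ) :
    LinearMap.det (duhOp U θ) = ∏ i : Fin N, ∏ j ∈ Ioi i, Real.sinc ((θ j - θ i) / 2) ^ 2 := by
  have h := LinearMap.det_conj (hadSU (duhMat θ) (duhMat_diag θ) (duhMat_conj θ)) (adSU (N := N) U)
  rw [det_hadSU] at h
  refine h.trans ?_
  rw [← prod_pairs_eq fun i j => Real.sinc ((θ j - θ i) / 2) ^ 2]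
  exact Finset.prod_congr rfl fun p _ => normSq_duhCoeff _

end Frame

end Summit.QuantumFields.BalabanUV.T4Continuum.ShellMeasureDuhamelHadamardSUN

end
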